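import Summits.QuantumFields.YangMills.Theorems.BalabanUVNodesN21ShellSplitOfRecord13CoPHStat
import Summits.QuantumFields.BalabanUV.T4Continuum.Support.ShellMeasureScalingLocal

/-!
# N21 (NE7c) · JUNCTION №4 — TREE GAUGE AT THE CUBE LAW (repair (R2) of the seat's LOCATED-1): (M1) for dag-n21-d's `a`-truncated cube law `cubeLawOfDatum₉ … t a` along a
# gauge-invariant statistic ⟺ (M1) for the TREE-GAUGE-FIXED law `(fieldMeasure).withDensity (cubeDensityOfDatum₉ … t a ∘ fixTo T U₀)` along the statistic `∘ fixTo T U₀`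
# (pub-balaban `ShellMeasureScalingLocal.slotAntiConcentration_gaugeFixed_iff`, loop-free `T`); and dag-n21-d's END at the reading of record FROM per-cube gauge-fixed (M1)

Track A of `YM-PLAN.md` (cell `pub-ymgap`, HUMAN RULING D-0062 ∕ D-0149 width seats), node **N21**; WIDTH SEAT `pub-ymgap-dag-n21-w2` (gen 2), file 18.  THEOREMS ONLY: 0 `def`, 0 `sorry`;
COUNT-NEUTRAL; `--kind proof --supports stmt-QuantumFields-20544 --as helper`.  Imports dag-n21-d's FILE 6 `…N21ShellSplitOfRecord13CoPHStat` (p597562: ★★★★'s road — `…_of_liveSel`,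
`cubeAC_of_slotAntiConcentration`, `cubeLawOfDatum₉_eq_withDensity`, `measurable_cubeDensityOfDatum₉`, `cubeStat`, `measurable_cubeStat`, `cubeStat_lt_iff`, …) and pub-balaban's
`Support/ShellMeasureScalingLocal` (§3 TREE GAUGE).  NO Theses import.  Restates nothing; cites by name.

WHY (the seat's LOCATED-1, bus 2026-08-28 06:58Z, certificate p612378 `…N21ChartRoadWindowVacuity`).  At a block holding every bond of some site the chart road's WINDOW letter
about a fixed centre and the PRINTED gauge invariance of the dressed density are inhabited only by the zero fibre law — a window can only be asked AFTER a gauge is fixed.  pub-balaban's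
`ShellMeasureScalingLocal` §3 says exactly where: «(M1) for the realized law is EQUIVALENT to (M1) for the pair precomposed with the tree-gauge map `U ↦ U[T := U₀]` … the window
factorisation … is to be asked of `F ∘ fixTo T U₀`».  This file puts that sentence on dag-n21-d's cube law of record, BEFORE the block disintegration: the per-cube (M1) may be
proved for the gauge-fixed density, whose block fibres CAN carry a window.

WHAT IS PROVED ([bookkeeping]; one application each).
* §1 `slotAntiConcentration_cubeLaw_iff_gaugeFixed` — for ANY truncated law of the family (`ϑ`, `Dt`, `p`, `g`, `k`, `t`, `a`), ANY loop-free bond set `T` and reference field `U₀`,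
  ANY measurable gauge-invariant statistic `u`, GIVEN gauge invariance of the cube density `cubeDensityOfDatum₉ … t a` (LETTER — [RG-I] p.263, [III] (2.16)–(2.17)):
  `SlotAntiConcentration ((fieldMeasure).withDensity (cubeDensityOfDatum₉ … t a ∘ fixTo T U₀)) (u ∘ fixTo T U₀) θ ρ D ↔ SlotAntiConcentration (cubeLawOfDatum₉ … t a) u θ ρ D`
  ((H-U), (H-ζ), the datum's averaging measurability displayed for measurability; `cubeLawOfDatum₉_eq_withDensity` + `slotAntiConcentration_gaugeFixed_iff`).
* §2 ★★ `shellWeightBound_crOfRecord₁₃At_shellSplit_of_gaugeFixedCubeAC` — dag-n21-d's END at `crOfRecord₁₃At K₀ jcut (shellSplitOfRecord₁₃At N K₀ ρA ρB)` on the live-selector line from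
  the usual rows (`hsel`, (H-U), (H-ζ), `0 ≤ ζ`, width signs, `0 ≤ D_K`, `Σ D_K ρ_K < ∞`) and, per (run, K, `|t| ≤ 1`, top cube `a`), an ∃-package `(T, U₀)`: `NoClosedLoop T`, gauge
  invariance of the cube density AND of the cube statistic of record `cubeStat a` (two LETTERS), and (M1) for the GAUGE-FIXED cube law along `cubeStat a ∘ fixTo T U₀` below `ε_k` at width
  `ρ_K` with constant `D_K` — ★★★★'s road with its last step (block disintegration of the ungauged law) replaced by §1.

HONEST FRAMING.  The gauge invariance of the dressed cube density and of the cube statistic (the (2.16) background's covariance) are PRINTED but NOT tree theorems — displayed letters; the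
gauge-fixed per-cube (M1) is the located estimate (to be disintegrated along blocks of the gauge-fixed density and charted — not done here); `hsel`, (H-ζ), widths, `D_K` HYPOTHESES; K0⁷
OPEN; nothing of Bałaban's asserted; NE7c NOT PRINTED ∕ NOT proved; **N21 NOT discharged**; K3⁷ NOT claimed; counts UNMOVED (typed 28∕28 · discharged 5∕27); one finite four-torus
programme at fixed `ε` — NOT ℝ⁴, NOT infinite volume, NOT OS, NOT a mass gap, NOT Clay.  No decl below carries a cite tag.
-/

set_option autoImplicit false

open scoped BigOperators ENNReal
open Finset MeasureTheory Function

namespace Summit.QuantumFields.YangMills.Theorems.N21ChartJunctionKeyed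

open Literature.MathematicalPhysics.QuantumFieldTheory.Balaban1983to89
open Literature.MathematicalPhysics.QuantumFieldTheory.Balaban1983to89.T4Continuum
open Literature.MathematicalPhysics.QuantumFieldTheory.Balaban1983to89.Node00
open T4ShellMeasure (SlotAntiConcentration)
open T4IndicatorShell (ShellWeightBound)
open T4TreeGaugeFixing (NoClosedLoop fixTo)
open GaugeField (GaugeInvariant)
open YMDAG.UVSplit (crOfRecord₁₃At ShellSplit₁₃CoPH runA₁₃ runB₁₃ histA₁₃ histB₁₃)
open Summit.QuantumFields.YangMills.Theorems.N21ShellSplitOfRecord13CoPH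
open Summit.QuantumFields.YangMills.BalabanUVNodes.N19MGFFormAtRecord (wOfRecord₉_nonneg)
open Summit.QuantumFields.BalabanUV.T4Continuum.ShellMeasureScalingLocal (slotAntiConcentration_gaugeFixed_iff)

/-! ## §1 (M1) for the cube law ⟺ (M1) for its tree-gauge-fixed density -/

section CubeLaw

variable (F : T4Family) (N : ℕ) [NeZero N] (ϑ : Stage9Params F N) (Dt : FiniteEpsData F (SU N)) (g₀ : ℕ → ℝ)
  (os : List (ULoop F)) (p : B12.RunParams) (g : ℕ → ℝ) (k : ℕ)

/-- **TREE GAUGE AT THE CUBE LAW.**  For a loop-free bond set `T`, a reference field `U₀`, a measurable gauge-invariant statistic `u` and a GAUGE-INVARIANT cube density (letter),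
(M1) for the tree-gauge-fixed law `(fieldMeasure).withDensity (cubeDensityOfDatum₉ … t a ∘ fixTo T U₀)` along `u ∘ fixTo T U₀` is EQUIVALENT to (M1) for `cubeLawOfDatum₉ … t a` along `u`,
same `θ ρ D` (`cubeLawOfDatum₉_eq_withDensity` + pub-balaban `slotAntiConcentration_gaugeFixed_iff`). [bookkeeping] -/
theorem slotAntiConcentration_cubeLaw_iff_gaugeFixed (hU : LocalBgMeasurable F N ϑ.ν) (hζm : ZetaMeasurable F N ϑ.ζ) (hD : Dt.AvgMeasurable) (t : ℝ)
    (a : ↥(cubeIndices (F.P p.K) (cubeSide (F.P p.K).L ϑ.ν.M₂ (RkOfRecord (F.P p.K).L ϑ.ν.r (g k)) k)))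
    {T : Finset (PBond (F.P p.K) k)} (hT : NoClosedLoop T) (U₀ : GaugeField (F.P p.K) k (SU N))
    (hFi : GaugeInvariant (cubeDensityOfDatum₉ F N ϑ Dt g₀ os p g k t a))
    {u : GaugeField (F.P p.K) k (SU N) → ℝ} (hu : Measurable u) (hui : GaugeInvariant u) {θ ρ D : ℝ} :
    SlotAntiConcentration ((fieldMeasure (F.P p.K) k (SU N)).withDensity (cubeDensityOfDatum₉ F N ϑ Dt g₀ os p g k t a ∘ fixTo T U₀)) (u ∘ fixTo T U₀) θ ρ D ↔
      SlotAntiConcentration (cubeLawOfDatum₉ F N ϑ Dt g₀ os p g k t a) u θ ρ D := by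
  rw [cubeLawOfDatum₉_eq_withDensity F N ϑ Dt g₀ os p g k hU hζm hD t a]
  exact slotAntiConcentration_gaugeFixed_iff hT U₀ (measurable_cubeDensityOfDatum₉ F N ϑ Dt g₀ os p g k hU hζm hD t a) hFi hu hui

end CubeLaw

/-! ## §2 dag-n21-d's END from per-cube GAUGE-FIXED (M1) -/

section AtRecord

variable {F : T4Family} {N : ℕ} [NeZero N]

/-- ★★ **dag-n21-d's END AT THE READING OF RECORD FROM PER-CUBE (M1) IN A TREE GAUGE.**  `ShellWeightBound` at `crOfRecord₁₃At K₀ jcut (shellSplitOfRecord₁₃At N K₀ ρA ρB)` on the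
live-selector line from n20-d's rows (`hsel`, (H-U), (H-ζ), `0 ≤ ζ`), the width letters' signs, `0 ≤ D_K`, `Σ_K D_K ρ_K < ∞`, and — per (run, K, `|t| ≤ 1`, top cube `a`) — an ∃-package
`(T, U₀)`: a LOOP-FREE bond set, a reference field, GAUGE INVARIANCE of the cube density and of the cube statistic of record (letters), and (M1) for the TREE-GAUGE-FIXED cube law along
`cubeStat a ∘ fixTo T U₀` below `ε_k` at width `ρ_K` with constant `D_K` (★★★★'s road: `…_of_liveSel` ∘ `cubeAC_of_slotAntiConcentration` ∘ §1). [bookkeeping] -/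
theorem shellWeightBound_crOfRecord₁₃At_shellSplit_of_gaugeFixedCubeAC (K₀ : ℕ) (jcut : ℕ → ℕ) (ρA ρB : WidthLetter₁₃CoPH N) (θ : Stage13HParams F N)
    (hP : θ.Provisos₁₃CoPH F N) (g₀ : ℕ → ℝ) (os : List (ULoop F)) (E : B12.RunParams → ℝ)
    (hsel : θ.ppSel = ppSelLiveOfRecord F N θ.ν θ.τ9 E (wOfRecord₉ F N θ.toStage9Params))
    (hU : LocalBgMeasurable F N θ.ν) (hζm : ZetaMeasurable F N θ.ζ) (hζ0 : ∀ p g k s Pl Ql RS U V', 0 ≤ θ.ζ p g k s Pl Ql RS U V')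
    {DA DB : ℕ → ℝ} (hρA : ∀ K, 0 ≤ ρA F θ hP g₀ os K) (hDA : ∀ K, 0 ≤ DA K) (hρB : ∀ K, 0 ≤ ρB F θ hP g₀ os K) (hDB : ∀ K, 0 ≤ DB K)
    (hsA : Summable (fun K => DA K * ρA F θ hP g₀ os K)) (hsB : Summable (fun K => DB K * ρB F θ hP g₀ os K))
    (hcubeA : ∀ (K : ℕ) (t : ℝ), |t| ≤ 1 →
      ∀ (a : ↥(cubeIndices (F.P (K₀ + K)) (cubeSide (F.P (K₀ + K)).L θ.ν.M₂ (RkOfRecord (F.P (K₀ + K)).L θ.ν.r (histA₁₃ θ K₀ g₀ K (K₀ + K))) (K₀ + K)))),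
        ∃ (T : Finset (PBond (F.P (K₀ + K)) (K₀ + K))) (U₀ : GaugeField (F.P (K₀ + K)) (K₀ + K) (SU N)),
          NoClosedLoop T ∧ GaugeInvariant (cubeDensityOfDatum₉ F N θ.toStage9Params (datumOfRecord₁₃CoPH F N θ hP) g₀ os (runA₁₃ F K₀ g₀ K) (histA₁₃ θ K₀ g₀ K) (K₀ + K) t a) ∧ GaugeInvariant (cubeStat F N θ.ν (histA₁₃ θ K₀ g₀ K) (Kc := K₀ + K) (k := K₀ + K) a) ∧
          SlotAntiConcentration ((fieldMeasure (F.P (K₀ + K)) (K₀ + K) (SU N)).withDensity ((cubeDensityOfDatum₉ F N θ.toStage9Params (datumOfRecord₁₃CoPH F N θ hP) g₀ os (runA₁₃ F K₀ g₀ K) (histA₁₃ θ K₀ g₀ K) (K₀ + K) t a) ∘ fixTo T U₀))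
            ((cubeStat F N θ.ν (histA₁₃ θ K₀ g₀ K) (Kc := K₀ + K) (k := K₀ + K) a) ∘ fixTo T U₀) (epsOfRecord θ.ν (histA₁₃ θ K₀ g₀ K) (K₀ + K)) (ρA F θ hP g₀ os K) (DA K))
    (hcubeB : ∀ (K : ℕ) (t : ℝ), |t| ≤ 1 →
      ∀ (a : ↥(cubeIndices (F.P (K₀ + K + 1)) (cubeSide (F.P (K₀ + K + 1)).L θ.ν.M₂ (RkOfRecord (F.P (K₀ + K + 1)).L θ.ν.r (histB₁₃ θ K₀ g₀ K (K₀ + K + 1))) (K₀ + K + 1)))),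
        ∃ (T : Finset (PBond (F.P (K₀ + K + 1)) (K₀ + K + 1))) (U₀ : GaugeField (F.P (K₀ + K + 1)) (K₀ + K + 1) (SU N)),
          NoClosedLoop T ∧ GaugeInvariant (cubeDensityOfDatum₉ F N θ.toStage9Params (datumOfRecord₁₃CoPH F N θ hP) g₀ os (runB₁₃ F K₀ g₀ K) (histB₁₃ θ K₀ g₀ K) (K₀ + K + 1) t a) ∧ GaugeInvariant (cubeStat F N θ.ν (histB₁₃ θ K₀ g₀ K) (Kc := K₀ + K + 1) (k := K₀ + K + 1) a) ∧
          SlotAntiConcentration ((fieldMeasure (F.P (K₀ + K + 1)) (K₀ + K + 1) (SU N)).withDensity ((cubeDensityOfDatum₉ F N θ.toStage9Params (datumOfRecord₁₃CoPH F N θ hP) g₀ os (runB₁₃ F K₀ g₀ K) (histB₁₃ θ K₀ g₀ K) (K₀ + K + 1) t a) ∘ fixTo T U₀))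
            ((cubeStat F N θ.ν (histB₁₃ θ K₀ g₀ K) (Kc := K₀ + K + 1) (k := K₀ + K + 1) a) ∘ fixTo T U₀) (epsOfRecord θ.ν (histB₁₃ θ K₀ g₀ K) (K₀ + K + 1)) (ρB F θ hP g₀ os K) (DB K))
    :
    ShellWeightBound (crOfRecord₁₃At K₀ jcut (shellSplitOfRecord₁₃At N K₀ ρA ρB) F θ hP g₀ os).l₀
      (crOfRecord₁₃At K₀ jcut (shellSplitOfRecord₁₃At N K₀ ρA ρB) F θ hP g₀ os).T (crOfRecord₁₃At K₀ jcut (shellSplitOfRecord₁₃At N K₀ ρA ρB) F θ hP g₀ os).A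
      (crOfRecord₁₃At K₀ jcut (shellSplitOfRecord₁₃At N K₀ ρA ρB) F θ hP g₀ os).B (crOfRecord₁₃At K₀ jcut (shellSplitOfRecord₁₃At N K₀ ρA ρB) F θ hP g₀ os).shA
      (crOfRecord₁₃At K₀ jcut (shellSplitOfRecord₁₃At N K₀ ρA ρB) F θ hP g₀ os).shB (crOfRecord₁₃At K₀ jcut (shellSplitOfRecord₁₃At N K₀ ρA ρB) F θ hP g₀ os).Wsh := by
  have hD : (datumOfRecord₁₃CoPH F N θ hP).AvgMeasurable := (isPrintedAveraged_datumOfRecord₁₃CoPH F N θ hP).avgMeasurable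
  have hw0 : ∀ (p : B12.RunParams) (g : ℕ → ℝ) k s' U V', 0 ≤ wOfRecord₉ F N θ.toStage9Params p g k s' U V' :=
    fun p g => wOfRecord₉_nonneg θ.toStage9Params hζ0 p g
  refine shellWeightBound_crOfRecord₁₃At_shellSplit_of_liveSel K₀ jcut ρA ρB θ hP g₀ os E hsel hU hζm hζ0 hρA hDA hρB hDB hsA hsB
    (fun K t ht a => ?_) (fun K t ht a => ?_)
  · refine cubeAC_of_slotAntiConcentration F N θ.toStage9Params (datumOfRecord₁₃CoPH F N θ hP) g₀ os (runA₁₃ F K₀ g₀ K) (histA₁₃ θ K₀ g₀ K) (K₀ + K)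
      hU (hw0 _ _) (hρA K) t a (fun s => integrable_topPieceA_of_liveSel K₀ θ hP E hsel hU hζm hζ0 g₀ os K t s)
      (cubeStat F N θ.ν (histA₁₃ θ K₀ g₀ K) (Kc := K₀ + K) (k := K₀ + K) a)
      (fun V => cubeStat_lt_iff F N θ.ν (histA₁₃ θ K₀ g₀ K) (K₀ + K) (K₀ + K) a (plaqInside_cubeEnl_nonempty F θ.ν _ _ _ a) _ V)
      (fun V => cubeStat_lt_iff F N θ.ν (histA₁₃ θ K₀ g₀ K) (K₀ + K) (K₀ + K) a (plaqInside_cubeEnl_nonempty F θ.ν _ _ _ a) _ V) (hDA K) ?_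
    obtain ⟨T, U₀, hT, hFi, hui, hAC⟩ := hcubeA K t ht a
    exact (slotAntiConcentration_cubeLaw_iff_gaugeFixed F N θ.toStage9Params (datumOfRecord₁₃CoPH F N θ hP) g₀ os (runA₁₃ F K₀ g₀ K) (histA₁₃ θ K₀ g₀ K) (K₀ + K)
      hU hζm hD t a hT U₀ hFi (measurable_cubeStat F N θ.ν (histA₁₃ θ K₀ g₀ K) (K₀ + K) (K₀ + K) hU a) hui).1 hAC
  · refine cubeAC_of_slotAntiConcentration F N θ.toStage9Params (datumOfRecord₁₃CoPH F N θ hP) g₀ os (runB₁₃ F K₀ g₀ K) (histB₁₃ θ K₀ g₀ K) (K₀ + K + 1)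
      hU (hw0 _ _) (hρB K) t a (fun s => integrable_topPieceB_of_liveSel K₀ θ hP E hsel hU hζm hζ0 g₀ os K t s)
      (cubeStat F N θ.ν (histB₁₃ θ K₀ g₀ K) (Kc := K₀ + K + 1) (k := K₀ + K + 1) a)
      (fun V => cubeStat_lt_iff F N θ.ν (histB₁₃ θ K₀ g₀ K) (K₀ + K + 1) (K₀ + K + 1) a (plaqInside_cubeEnl_nonempty F θ.ν _ _ _ a) _ V)
      (fun V => cubeStat_lt_iff F N θ.ν (histB₁₃ θ K₀ g₀ K) (K₀ + K + 1) (K₀ + K + 1) a (plaqInside_cubeEnl_nonempty F θ.ν _ _ _ a) _ V) (hDB K) ?_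
    obtain ⟨T, U₀, hT, hFi, hui, hAC⟩ := hcubeB K t ht a
    exact (slotAntiConcentration_cubeLaw_iff_gaugeFixed F N θ.toStage9Params (datumOfRecord₁₃CoPH F N θ hP) g₀ os (runB₁₃ F K₀ g₀ K) (histB₁₃ θ K₀ g₀ K) (K₀ + K + 1)
      hU hζm hD t a hT U₀ hFi (measurable_cubeStat F N θ.ν (histB₁₃ θ K₀ g₀ K) (K₀ + K + 1) (K₀ + K + 1) hU a) hui).1 hAC

end AtRecord

end Summit.QuantumFields.YangMills.Theorems.N21ChartJunctionKeyed
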